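import Mathlib
import Summits.Ventures.PercRepro.TriangleCapCherryDiamond
import Summits.Ventures.PercRepro.TriangleCapDiagonal

/-!
# PercRepro — the pairs off a vertex of a `K₄⁻`-free graph: the exact per-pair degree bound, the matching
property of a neighbourhood, and the disjoint matching pair (p3, gen 30; part 1 of the row `m = k + 1`)

The row `m = k + 1` of the lane's cherry table (TriangleCapRowPlusOne) needs the vertex count of
TriangleCapDiagonal refined at the matching edges of a neighbourhood.  This module holds the local facts:

* `deg_add_deg_add_deg_le_of_adj_ind` — for `x ~ y` off `v`: `d(x) + d(y) + d(v) ≤ m + 1 + [v ~ x] + [v ~ y]`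
  (the edges at `v` meeting `{x, y}` are among `s(v,x)`, `s(v,y)`, and only those with `v ~ x` / `v ~ y` exist);
* `deg_add_deg_add_deg_le_of_adj_of_disjoint_edge` — one unit better when an edge `a ~ b` with `a, b ∉ {x, y, v}`
  exists: `d(x) + d(y) + d(v) ≤ m + 2`;
* `card_filter_adj_neighbors_le_one` — the matching property of a `K₄⁻`-free graph: a neighbour of `v` has at
  most one neighbour inside `N(v)` (`card_inter_le_one_of_adj`);
* `offPairs D v` — the adjacent ordered pairs `(x, y)` with `x, y ≠ v` (TriangleCapDiagonal's `R`, as one filter),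
  `mem_offPairs`, `filter_not_fst_filter_not_snd`, the pairs starting in `N(v)` (`filter_offPairs_fst_eq`) and the
  matching pairs with both coordinates in `N(v)` (`filter_offPairs_both_eq`), `card_filter_product_adj`.

Axioms: standard.
-/

namespace PercRepro

namespace TriangleCap

namespace C047

open Finset

variable {V : Type*} [Fintype V] [DecidableEq V]

/-- The edges at `v` containing `x` or `y` (`x, y ≠ v`) number at most `[v ~ x] + [v ~ y]`. -/
theorem card_incidenceFinset_inter_union_le (D : SimpleGraph V) [DecidableRel D.Adj] {v x y : V}
    (hx : x ≠ v) (hy : y ≠ v) :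
    (D.incidenceFinset v ∩ (D.incidenceFinset x ∪ D.incidenceFinset y)).card ≤
      (if D.Adj v x then 1 else 0) + (if D.Adj v y then 1 else 0) := by
  have hsub : D.incidenceFinset v ∩ (D.incidenceFinset x ∪ D.incidenceFinset y) ⊆
      ({s(v, x)} : Finset (Sym2 V)).filter (fun _ => D.Adj v x) ∪
        ({s(v, y)} : Finset (Sym2 V)).filter (fun _ => D.Adj v y) := by
    intro e he
    have he' := incidenceFinset_inter_union_subset D hx hy he
    rw [mem_insert, mem_singleton] at he'
    have hE : e ∈ D.edgeSet := by
      have h0 := (mem_inter.mp he).1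
      rw [SimpleGraph.mem_incidenceFinset] at h0
      exact h0.1
    rw [mem_union, mem_filter, mem_filter, mem_singleton, mem_singleton]
    rcases he' with rfl | rfl
    · exact Or.inl ⟨rfl, D.mem_edgeSet.mp hE⟩
    · exact Or.inr ⟨rfl, D.mem_edgeSet.mp hE⟩
  refine (card_le_card hsub).trans ((card_union_le _ _).trans ?_)
  rw [filter_singleton, filter_singleton]
  split_ifs <;> simp

/-- **The exact per-pair bound:** for `x ~ y` off `v`, `d(x) + d(y) + d(v) ≤ m + 1 + [v ~ x] + [v ~ y]`. -/
theorem deg_add_deg_add_deg_le_of_adj_ind (D : SimpleGraph V) [DecidableRel D.Adj] {v x y : V}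
    (h : D.Adj x y) (hx : x ≠ v) (hy : y ≠ v) :
    deg D x + deg D y + deg D v ≤
      D.edgeFinset.card + 1 + (if D.Adj v x then 1 else 0) + (if D.Adj v y then 1 else 0) := by
  have h1 := card_union_add_card_inter (D.incidenceFinset x) (D.incidenceFinset y)
  rw [incidenceFinset_inter_of_adj D h, card_singleton] at h1
  have h2 := card_union_add_card_inter (D.incidenceFinset x ∪ D.incidenceFinset y)
    (D.incidenceFinset v)
  have h3 := card_incidenceFinset_inter_union_le D hx hy
  rw [inter_comm] at h3
  have h4 : (D.incidenceFinset x ∪ D.incidenceFinset y ∪ D.incidenceFinset v).card ≤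
      D.edgeFinset.card :=
    card_le_card (union_subset (union_subset (D.incidenceFinset_subset x)
      (D.incidenceFinset_subset y)) (D.incidenceFinset_subset v))
  rw [deg_eq_card_incidenceFinset, deg_eq_card_incidenceFinset, deg_eq_card_incidenceFinset]
  split_ifs at h3 ⊢ <;> omega

/-- **One unit better with a disjoint edge:** for `x ~ y` off `v` and an edge `a ~ b` with `a, b ∉ {x, y, v}`,
`d(x) + d(y) + d(v) ≤ m + 2`. -/
theorem deg_add_deg_add_deg_le_of_adj_of_disjoint_edge (D : SimpleGraph V) [DecidableRel D.Adj]
    {v x y a b : V} (h : D.Adj x y) (hx : x ≠ v) (hy : y ≠ v) (hab : D.Adj a b) (ha : a ≠ v) (hb : b ≠ v)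
    (hax : a ≠ x) (hay : a ≠ y) (hbx : b ≠ x) (hby : b ≠ y) :
    deg D x + deg D y + deg D v ≤ D.edgeFinset.card + 2 := by
  have h1 := card_union_add_card_inter (D.incidenceFinset x) (D.incidenceFinset y)
  rw [incidenceFinset_inter_of_adj D h, card_singleton] at h1
  have h2 := card_union_add_card_inter (D.incidenceFinset x ∪ D.incidenceFinset y)
    (D.incidenceFinset v)
  have h3 : ((D.incidenceFinset x ∪ D.incidenceFinset y) ∩ D.incidenceFinset v).card ≤ 2 := by
    rw [inter_comm]
    exact (card_le_card (incidenceFinset_inter_union_subset D hx hy)).trans card_le_two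
  have hnot : s(a, b) ∉ D.incidenceFinset x ∪ D.incidenceFinset y ∪ D.incidenceFinset v := by
    intro hmem
    rw [mem_union, mem_union, SimpleGraph.mem_incidenceFinset, SimpleGraph.mem_incidenceFinset,
      SimpleGraph.mem_incidenceFinset] at hmem
    rcases hmem with (hm | hm) | hm
    · rcases Sym2.mem_iff.mp hm.2 with h' | h'
      · exact hax h'.symm
      · exact hbx h'.symm
    · rcases Sym2.mem_iff.mp hm.2 with h' | h'
      · exact hay h'.symm
      · exact hby h'.symm
    · rcases Sym2.mem_iff.mp hm.2 with h' | h'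
      · exact ha h'.symm
      · exact hb h'.symm
  have h4 : (insert s(a, b) (D.incidenceFinset x ∪ D.incidenceFinset y ∪ D.incidenceFinset v)).card ≤
      D.edgeFinset.card :=
    card_le_card (insert_subset (SimpleGraph.mem_edgeFinset.mpr hab)
      (union_subset (union_subset (D.incidenceFinset_subset x) (D.incidenceFinset_subset y))
        (D.incidenceFinset_subset v)))
  rw [card_insert_of_notMem hnot] at h4
  rw [deg_eq_card_incidenceFinset, deg_eq_card_incidenceFinset, deg_eq_card_incidenceFinset]
  omega

/-- **The matching property:** in a `K₄⁻`-free graph a neighbour `w` of `v` has at most one neighbour in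
`N(v)`. -/
theorem card_filter_adj_neighbors_le_one (D : SimpleGraph V) [DecidableRel D.Adj] (hK : K4mFree D)
    {v w : V} (h : D.Adj v w) :
    ((univ.filter (fun x => D.Adj v x)).filter (fun x => D.Adj w x)).card ≤ 1 := by
  refine le_trans (card_le_card ?_) (card_inter_le_one_of_adj D hK h)
  intro x hx
  rw [mem_filter] at hx
  rw [mem_inter]
  exact ⟨hx.1, mem_filter.mpr ⟨mem_univ _, hx.2⟩⟩

omit [Fintype V] [DecidableEq V] in
/-- The adjacent pairs of `A × B`, counted vertex by vertex. -/
theorem card_filter_product_adj (D : SimpleGraph V) [DecidableRel D.Adj] (A B : Finset V) :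
    ((A ×ˢ B).filter (fun p => D.Adj p.1 p.2)).card = ∑ w ∈ A, (B.filter (fun x => D.Adj w x)).card := by
  rw [card_filter, sum_product]
  apply sum_congr rfl
  intro w _
  rw [card_filter]

/-! ### The pairs off a vertex `v` -/

/-- The adjacent ordered pairs `(x, y)` with `x, y ≠ v` (module TriangleCapDiagonal's `R`). -/
def offPairs (D : SimpleGraph V) [DecidableRel D.Adj] (v : V) : Finset (V × V) :=
  (univ ×ˢ univ).filter (fun p => D.Adj p.1 p.2 ∧ ¬ p.1 = v ∧ ¬ p.2 = v)

/-- Membership in `offPairs`. -/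
theorem mem_offPairs (D : SimpleGraph V) [DecidableRel D.Adj] (v : V) (p : V × V) :
    p ∈ offPairs D v ↔ D.Adj p.1 p.2 ∧ ¬ p.1 = v ∧ ¬ p.2 = v := by
  unfold offPairs
  rw [mem_filter, mem_product]
  simp only [mem_univ, true_and]

/-- TriangleCapDiagonal's nested filter is `offPairs`. -/
theorem filter_not_fst_filter_not_snd (D : SimpleGraph V) [DecidableRel D.Adj] (v : V) :
    ((adjPairsAll D).filter (fun p => ¬ p.1 = v)).filter (fun p => ¬ p.2 = v) = offPairs D v := by
  ext p
  rw [mem_offPairs]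
  simp only [adjPairsAll, mem_filter, mem_product, mem_univ, true_and]
  tauto

/-- The pairs off `v` starting in `N(v)` are the adjacent pairs of `N(v) × (V ∖ {v})`. -/
theorem filter_offPairs_fst_eq (D : SimpleGraph V) [DecidableRel D.Adj] (v : V) :
    (offPairs D v).filter (fun p => D.Adj v p.1) =
      ((univ.filter (fun w => D.Adj v w)) ×ˢ (univ.erase v)).filter (fun p => D.Adj p.1 p.2) := by
  ext p
  rw [mem_filter, mem_offPairs, mem_filter, mem_product, mem_filter, mem_erase]
  simp only [mem_univ, true_and, and_true, ne_eq]
  constructor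
  · rintro ⟨⟨h1, _, h3⟩, h4⟩
    exact ⟨⟨h4, h3⟩, h1⟩
  · rintro ⟨⟨h4, h3⟩, h1⟩
    exact ⟨⟨h1, fun h => D.ne_of_adj h4 h.symm, h3⟩, h4⟩

/-- The matching pairs (both coordinates in `N(v)`) are the adjacent pairs of `N(v) × N(v)`. -/
theorem filter_offPairs_both_eq (D : SimpleGraph V) [DecidableRel D.Adj] (v : V) :
    (offPairs D v).filter (fun p => D.Adj v p.1 ∧ D.Adj v p.2) =
      ((univ.filter (fun w => D.Adj v w)) ×ˢ (univ.filter (fun w => D.Adj v w))).filter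
        (fun p => D.Adj p.1 p.2) := by
  ext p
  rw [mem_filter, mem_offPairs, mem_filter, mem_product, mem_filter, mem_filter]
  simp only [mem_univ, true_and]
  constructor
  · rintro ⟨⟨h1, _, _⟩, h4, h5⟩
    exact ⟨⟨h4, h5⟩, h1⟩
  · rintro ⟨⟨h4, h5⟩, h1⟩
    exact ⟨⟨h1, fun h => D.ne_of_adj h4 h.symm, fun h => D.ne_of_adj h5 h.symm⟩, h4, h5⟩

end C047

end TriangleCap

end PercRepro
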